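import Summits.QuantumFields.YangMills.Theorems.UnitScaleTiltProp7OneFormPointwiseDecayRate
import Summits.QuantumFields.YangMills.Theorems.UnitScaleTiltProp7OneFormAgmonPhaseClass
import Summits.QuantumFields.YangMills.Theorems.UnitScaleTiltProp7OneFormAgmonLocal
import Summits.QuantumFields.YangMills.Theorems.UnitScaleTiltProp7QkPenaltyKernelRowOfRegPr
import Summits.QuantumFields.YangMills.Theorems.UnitScaleTiltProp7QkAdjointSupRowOfRegPr
import Summits.QuantumFields.YangMills.Theorems.UnitScaleTiltProp7DivergenceAbsorptionOfRegPr
import Summits.QuantumFields.YangMills.Theorems.UnitScaleTiltProp7NSIntertwinerOfRecord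
import Summits.QuantumFields.YangMills.Theorems.UnitScaleTiltProp7LiftOfRSEqPrintProjector
import Summits.QuantumFields.YangMills.Theorems.UnitScaleTiltProp7QkOntoOfRegPr
import HarnessLib

/-!
# Route `UnitScaleTilt`, crux K1 «MinimiserStabilityRegPr» (stmt-QuantumFields-19200), EX face S46 — (L3′b)-VALUE, ONE-FORM STOREY, FILE (K2-DISCHARGE, D1):
# **THE KERNEL ROW OF `G₀ = Δ_a(U₀)⁻¹` UNDER `Lift` AT `RegPr` — EVERY ANALYTIC LETTER OF (K2)∕(RATE) FED BY NAME EXCEPT (γ) AND `hk_D`**, which stay displayed in the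
# texts their Idx-packages export (★p1 g27 ✓∕⧗`hco_DeltaEtaSlot_exists`, px10 ✓`kernelRow349_allMembers_exists` read through `Lift`)

Cell `ym3-torus` (HUMAN RULING D-0037; rung R3 = SU(2) YM₃ on T³ — NOT d = 4, NOT infinite volume, NOT a mass gap, NOT Clay).  Chair ★`ym-ust-19200-p1` g27 CHAIR WORD №23 «GO
(K2-DISCHARGE)»; width seat `ym3-torus-px16` g13 (`--supports stmt-QuantumFields-19200 --as helper`).  THEOREMS ONLY (0 `def`, 0 `sorry`); count-neutral.

WHAT IS FED (LOCATE-K2-DISCHARGE, HOME `ym3-torus-px16/g13/`): (C_V) `hVlow` — ASSEMBLED HERE (§1) from A1 ✓`Prop7OneFormGarding.inner_laplaceA_eq`∕`re_remainder_ge`, the local letter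
px21 ✓`Prop7OneFormAgmonLocal.abs_re_inner_local_le` (`C_loc = 32√2ε₀·d·6^d`) and the `H¹` divergence absorption ✓`Prop7DivergenceAbsorptionOfRegPr.normSq_DstarL2_le_normSq_projR_add_of_regPr'`
(`C_P = (m_B²a)⁻¹`) read through `Lift` (`R_S = projR (Δ_U₀) Q″`, ✓`RS_eq_projR_iff_lift` + ✓`exists_intertwiner_of_regPr`); (θ_V-class) `hVconj` ⟸ px21 ✓`hVconj_phaseClass_of_letters`
(its `hk` = `hk_D`, its `hQ` ⟸ px17 ✓`norm_Qk_le_of_regPr`); `hk_Q` ⟸ px21 ✓`hkQ_of_regPr`; `PosOnto` ⟸ (γ) `> 0` + ✓`surjective_Qk_of_regPr`.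
WHAT IS PROVED (ns `Summit.QuantumFields.YangMills.Theorems.Prop7OneFormGreenKernelRowOfLift`; member `F`, `n < K`, `ℓ = L^{K−n}`).
* §1 ★★ `hVlow_of_lift` — (C_V) at `RegPr` + `Lift`: `−(C_loc + C_P)·‖toL2 X‖² ≤ re⟪toL2 X, Δ_a^{DeltaEtaSlot}(toL2 X)⟫ − Σ_μ‖D_U₀(toL2S X_μ)‖²` for EVERY `X` (`C_P` at a free
  coarse weight `c₁′ > 0`), with `norm_sq_sub_RS_eq` (Pythagoras for `R_S`).
* §2 ★★★ `kernelRow_GT_DeltaEtaSlot_of_lift` — ROW(G₀; √2·A₁, `min r (1∕4)∕2`) in O4e's `hk` text, displaying ONLY: `RegPr` + the windows `10¹²L³ε₀ ≤ 1`, `10¹⁰L⁶ε₀ ≤ 1`,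
  `13·10¹⁴L³ε₀ ≤ 1`; `Lift`; (γ) `hco`; `hk_D` (E2E's text, rate `μ′ > r`); and the two NUMERIC conditions on `(r, ε)`: `0 < Θ` (A4b's floor with `C_V`, `θ_V` now EXPLICIT in
  `ε₀, a, c₀, cB, CkD, r, μ′`) and `(32√2ε₀e^{5r})(8e^{3r})·14 < 1` — chosen by the Idx package (D2).
HONEST SCOPE.  Plumbing over landed letters; CONDITIONAL on (γ), `hk_D`, `Lift`, the numeric conditions; `C_P = (m_B²a)⁻¹` grows with the coupling `a` (K-freeness at a member is a
matter of the pins); nothing of the EX rows, EX or the crux is proved; no summit is proved by a helper.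

References: T. Bałaban, CMP **99** (1985) 389–434 [Balaban1985BackgroundPropagators] (Thm 3.1 (3.42) p.397, (3.21)–(3.27) pp.394–395, (3.46) p.398, (3.49) p.399, Thm 3.11 p.416,
Thm 3.12 p.422); CMP **102** (1985) 277–309 [Balaban1985Variational] ((134)–(136) p.298).
-/

set_option autoImplicit false

noncomputable section

open scoped Matrix.Norms.L2Operator BigOperators InnerProductSpace ComplexConjugate

namespace Summit.QuantumFields.YangMills.Theorems.Prop7OneFormGreenKernelRowOfLift

open Literature.MathematicalPhysics.QuantumFieldTheory.Balaban1983to89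
open Literature.MathematicalPhysics.QuantumFieldTheory.Balaban1983to89.T3ContinuumYM3Torus
open Literature.MathematicalPhysics.QuantumFieldTheory.Balaban1983to89.T3PrintedRegularMinimiser (RegPr)
open T4Continuum BlockAveraging
open BlockAveraging (Idx)
open B7Prop1Explicit (disp)
open B10Eq27TorusAxialLog (holT transl)
open B7TransferAnalyticMean (meanCLM)
open B15DeterminingSets (embIter)
open T3SectALandauChart (formComp bgUnits eta eta_pos)
open B4Sect5Torus (TSite)
open B9SectCLatticeCarrier (Bond)
open B9Eq311L2Pairing (WL2)
open B9TorusCalculus (torusT)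
open B9Eq310Hermitian (deltaPrimeOp)
open B11Eq135Weitzenbock (curvOp)
open B11Eq103H1Complex (SiteL2K BondL2K projR projR_isSymmetric projR_projR)
open B5Eq118OneStroke (iterBlockOf)
open Summit.QuantumFields.YangMills.Theorems.Prop8Chart (emlIterU)
open Summit.QuantumFields.YangMills.Theorems.Prop7SectET3Transport (periodsT3 siteEquiv bondEquiv)
open Summit.QuantumFields.YangMills.Theorems.Prop7SectET3HilbertLetters (W₂ frobEquiv toL2 toL2S DL2 DstarL2 covLapSite)
open Summit.QuantumFields.YangMills.Theorems.Prop7SectET3WilsonHessian (DeltaEta DeltaEtaSlot DeltaEtaSlot_apply)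
open Summit.QuantumFields.YangMills.Theorems.Prop7SectET3GaugeProjector (NS RS RS_eq_projR)
open Summit.QuantumFields.YangMills.Theorems.Prop7SectET3CurvedPropagators (laplaceA Qk GT PosOnto)
open Summit.QuantumFields.YangMills.Theorems.Prop7OneFormGarding (inner_laplaceA_eq re_remainder_ge)
open Summit.QuantumFields.YangMills.Theorems.Prop7OneFormAgmonLocal (abs_re_inner_local_le)
open Summit.QuantumFields.YangMills.Theorems.Prop7OneFormAgmonPhaseClass (hVconj_phaseClass_of_letters)
open Summit.QuantumFields.YangMills.Theorems.Prop7QkPenaltyKernelRowOfRegPr (hkQ_of_regPr)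
open Summit.QuantumFields.YangMills.Theorems.Prop7QkAdjointSupRowOfRegPr (norm_Qk_le_of_regPr)
open Summit.QuantumFields.YangMills.Theorems.Prop7DivergenceAbsorptionOfRegPr (normSq_DstarL2_le_normSq_projR_add_of_regPr')
open Summit.QuantumFields.YangMills.Theorems.Prop7NSIntertwinerOfRecord (exists_intertwiner_of_regPr)
open Summit.QuantumFields.YangMills.Theorems.Prop7LiftOfRSEqPrintProjector (RS_eq_projR_iff_lift)
open Summit.QuantumFields.YangMills.Theorems.Prop7QkOntoOfRegPr (surjective_Qk_of_regPr)
open Summit.QuantumFields.YangMills.Theorems.Prop7OneFormPointwiseDecayRate (kernelRow_GT_DeltaEtaSlot_rate)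

variable (F : T3Family) {n K : ℕ} (h : n ≤ K) (c₀ cB : ℝ) [Fact (0 < c₀)] [Fact (0 < cB)]

/-! ## §1 (C_V): the form lower bound `hVlow` at `RegPr` under `Lift` -/

omit [Fact (0 < cB)] in
/-- PYTHAGORAS FOR `R_S`: `‖g − R_S g‖² = ‖g‖² − ‖R_S g‖²` (`R_S` = lit `projR`, symmetric and idempotent: ✓`RS_eq_projR`, ✓`projR_isSymmetric`, ✓`projR_projR`).
[cite: Balaban1985BackgroundPropagators, (3.21) p.394] -/
theorem norm_sq_sub_RS_eq (U₀ : GaugeField (F.P K) 0 (Matrix.specialUnitaryGroup (Fin 2) ℂ)) (g : SiteL2K ℂ 3 (periodsT3 F K) c₀ W₂) :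
    ‖g - RS F n K h c₀ cB U₀ g‖ ^ 2 = ‖g‖ ^ 2 - ‖RS F n K h c₀ cB U₀ g‖ ^ 2 := by
  have hsymm : (RS F n K h c₀ cB U₀).IsSymmetric := by rw [RS_eq_projR]; exact projR_isSymmetric _ _
  have hidem : ∀ x, RS F n K h c₀ cB U₀ (RS F n K h c₀ cB U₀ x) = RS F n K h c₀ cB U₀ x := fun x => by
    rw [RS_eq_projR]; exact projR_projR _ _ x
  have horth : ⟪RS F n K h c₀ cB U₀ g, g - RS F n K h c₀ cB U₀ g⟫_ℂ = 0 := by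
    rw [hsymm, map_sub, hidem, sub_self, inner_zero_right]
  have hsum : ‖RS F n K h c₀ cB U₀ g + (g - RS F n K h c₀ cB U₀ g)‖ ^ 2 = ‖RS F n K h c₀ cB U₀ g‖ ^ 2 + ‖g - RS F n K h c₀ cB U₀ g‖ ^ 2 := by
    have h1 := @norm_add_sq ℂ _ _ _ _ (RS F n K h c₀ cB U₀ g) (g - RS F n K h c₀ cB U₀ g)
    rw [horth, map_zero, mul_zero, add_zero] at h1
    exact h1
  rw [add_sub_cancel] at hsum
  linarith

/-- ★★ **(C_V) `hVlow` AT `RegPr` UNDER `Lift`**: for `n < K`, `0 < ε₀`, `10¹²L³ε₀ ≤ 1`, `RegPr F n K ε₀ U₀`, `Lift`, any coupling `a > 0` and coarse weight `c₁′ > 0`, EVERY one-form `X`: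
`−(C_loc + C_P)·‖toL2 X‖² ≤ re⟪toL2 X, Δ_a^{DeltaEtaSlot}(U₀)(toL2 X)⟫ − Σ_μ ‖D_U₀(toL2S X_μ)‖²`, `C_loc = 32√2ε₀·d·6^d` (px21 ✓`abs_re_inner_local_le`),
`C_P = (m_B²a)⁻¹` (✓`normSq_DstarL2_le_normSq_projR_add_of_regPr'` for the intertwiner `Q″` of record, `R_S = projR … Q″` by `Lift`) — A1 ✓`inner_laplaceA_eq` + ✓`re_remainder_ge`; the
slot term vanishes at `DeltaEtaSlot`.  = the `hVlow` binder of A4∕A4b∕E2E∕(K2)∕(RATE) VERBATIM.  CONDITIONAL on `Lift`. [cite: Balaban1985BackgroundPropagators, (3.21)–(3.27) pp.394–395, Thm 3.11 p.416;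
Balaban1985Variational, (134)–(135) p.298] -/
theorem hVlow_of_lift (hnK : n < K) {ε₀ : ℝ} (hε₀ : 0 < ε₀) (hWε : 10 ^ 12 * (F.L : ℝ) ^ 3 * ε₀ ≤ 1)
    (U₀ : GaugeField (F.P K) 0 (Matrix.specialUnitaryGroup (Fin 2) ℂ)) (hreg : RegPr F n K ε₀ U₀)
    (hlift : ∀ cf : Site (F.P K) (K - n) → Matrix (Fin 2) (Fin 2) ℂ,
        (∀ e : PBond (F.P K) (K - n), cf e.src = ((emlIterU (K - n) (bgUnits F K U₀) e : (Matrix (Fin 2) (Fin 2) ℂ)ˣ) : Matrix (Fin 2) (Fin 2) ℂ) * cf e.tgt *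
          (((emlIterU (K - n) (bgUnits F K U₀) e)⁻¹ : (Matrix (Fin 2) (Fin 2) ℂ)ˣ) : Matrix (Fin 2) (Fin 2) ℂ)) →
        ∃ l₀ : Site (F.P K) 0 → Matrix (Fin 2) (Fin 2) ℂ,
          (∀ b : PBond (F.P K) 0, l₀ b.src = ((bgUnits F K U₀ b : (Matrix (Fin 2) (Fin 2) ℂ)ˣ) : Matrix (Fin 2) (Fin 2) ℂ) * l₀ b.tgt * (((bgUnits F K U₀ b)⁻¹ : (Matrix (Fin 2) (Fin 2) ℂ)ˣ) : Matrix (Fin 2) (Fin 2) ℂ)) ∧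
          ∀ y : Site (F.P K) (K - n), l₀ (embIter (K - n) y) = cf y)
    {a : ℝ} (ha : 0 < a) (c₁' : ℝ) (hc₁' : 0 < c₁') :
    ∀ X : PBond (F.P K) 0 → Matrix (Fin 2) (Fin 2) ℂ,
      -(((32 * Real.sqrt 2 * ε₀ * (((F.P K).d : ℝ) * (2 * 3) ^ (F.P K).d))
          + (((2 / ((1 + (25 / 8) * (c₁' * ((((F.P K).L : ℝ) ^ (F.P K).d) ^ (K - n))⁻¹ / c₀)) * (600 * (27 / 4 : ℝ) ^ 6 * (c₀ * ((F.L : ℝ) ^ 3) ^ (K - n) / c₁') + a))) ^ 2 * a)⁻¹))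
          * ‖toL2 F K c₀ X‖ ^ 2)
        ≤ RCLike.re ⟪toL2 F K c₀ X, laplaceA F n K h c₀ cB a (DeltaEtaSlot F n K c₀) U₀ (toL2 F K c₀ X)⟫_ℂ
          - ∑ μ : Fin (F.P K).d, ‖DL2 F n K c₀ U₀ (toL2S F K c₀ (formComp X μ))‖ ^ 2 := by
  intro X
  have hε7 : 10 ^ 7 * (F.L : ℝ) ^ 3 * ε₀ ≤ 1 := by
    have hL0 : (0 : ℝ) ≤ (F.L : ℝ) ^ 3 * ε₀ := by positivity
    nlinarith
  -- the intertwiner of record and `R_S = projR` on the Lift locus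
  obtain ⟨Q'', _D', _hint, _hD', htop, hseq, hker⟩ := exists_intertwiner_of_regPr (F := F) (c₀ := c₀) h cB hε₀ hWε U₀ hreg
  have hRS : RS F n K h c₀ cB U₀ = projR (covLapSite F n K c₀ U₀) Q'' :=
    (RS_eq_projR_iff_lift (F := F) h cB hε₀ hWε U₀ hreg Q'' htop hker).2 hlift
  -- (C_P): `‖D*v − R_S D*v‖² ≤ C_P‖v‖²`
  have hP : ‖DstarL2 F n K c₀ U₀ (toL2 F K c₀ X) - RS F n K h c₀ cB U₀ (DstarL2 F n K c₀ U₀ (toL2 F K c₀ X))‖ ^ 2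
      ≤ (((2 / ((1 + (25 / 8) * (c₁' * ((((F.P K).L : ℝ) ^ (F.P K).d) ^ (K - n))⁻¹ / c₀)) * (600 * (27 / 4 : ℝ) ^ 6 * (c₀ * ((F.L : ℝ) ^ 3) ^ (K - n) / c₁') + a))) ^ 2 * a)⁻¹) * ‖toL2 F K c₀ X‖ ^ 2 := by
    have hdiv := normSq_DstarL2_le_normSq_projR_add_of_regPr' F hε₀ hε7 U₀ hreg Q'' hseq hnK c₁' hc₁' ha (toL2 F K c₀ X)
    rw [← hRS] at hdiv
    rw [norm_sq_sub_RS_eq F h c₀ cB U₀]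
    linarith
  -- (C_loc)
  have hloc := abs_re_inner_local_le F c₀ U₀ hε₀.le hreg X
  -- A1's remainder bound and the identity
  have hrem := re_remainder_ge (h := h) (cB := cB) (a := a) U₀ X ha.le hloc hP
  have hid := inner_laplaceA_eq (h := h) (cB := cB) (a := a) (Δx := DeltaEtaSlot F n K c₀) U₀ X
  have hslot : (DeltaEtaSlot F n K c₀ U₀ - (DeltaEta F n K c₀ U₀ : BondL2K ℂ 3 (periodsT3 F K) c₀ W₂ →ₗ[ℂ] BondL2K ℂ 3 (periodsT3 F K) c₀ W₂)) (toL2 F K c₀ X) = 0 := by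
    have hop : (DeltaEtaSlot F n K c₀ U₀ - (DeltaEta F n K c₀ U₀ : BondL2K ℂ 3 (periodsT3 F K) c₀ W₂ →ₗ[ℂ] BondL2K ℂ 3 (periodsT3 F K) c₀ W₂)) = 0 := sub_self _
    rw [hop, LinearMap.zero_apply]
  rw [hslot, inner_zero_right, add_zero] at hid
  have hre := congrArg RCLike.re hid
  simp only [map_add, map_sub, map_sum] at hre
  have e1 : ∀ μ : Fin (F.P K).d, RCLike.re ((((‖DL2 F n K c₀ U₀ (toL2S F K c₀ (formComp X μ))‖ : ℝ) : ℂ)) ^ 2)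
      = ‖DL2 F n K c₀ U₀ (toL2S F K c₀ (formComp X μ))‖ ^ 2 := fun μ => by
    rw [← Complex.ofReal_pow]; exact Complex.ofReal_re _
  have e2 : RCLike.re ((((‖DstarL2 F n K c₀ U₀ (toL2 F K c₀ X) - RS F n K h c₀ cB U₀ (DstarL2 F n K c₀ U₀ (toL2 F K c₀ X))‖ : ℝ) : ℂ)) ^ 2)
      = ‖DstarL2 F n K c₀ U₀ (toL2 F K c₀ X) - RS F n K h c₀ cB U₀ (DstarL2 F n K c₀ U₀ (toL2 F K c₀ X))‖ ^ 2 := by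
    rw [← Complex.ofReal_pow]; exact Complex.ofReal_re _
  have e3 : RCLike.re (((a : ℝ) : ℂ) * (((‖Qk F n K h c₀ cB U₀ (toL2 F K c₀ X)‖ : ℝ) : ℂ)) ^ 2) = a * ‖Qk F n K h c₀ cB U₀ (toL2 F K c₀ X)‖ ^ 2 := by
    rw [← Complex.ofReal_pow, ← Complex.ofReal_mul]; exact Complex.ofReal_re _
  simp only [e1, e2, e3] at hre
  rw [hre]
  linarith

/-! ## §2 The kernel row of `G₀` under `Lift`: every letter but (γ) and `hk_D` fed by name -/

/-- ★★★ **THE KERNEL ROW OF `G₀ = Δ_a(U₀)⁻¹` AT `DeltaEtaSlot` UNDER `Lift` AT `RegPr`.**  Displayed: `n < K`; `RegPr F n K ε₀ U₀` with `0 < ε₀`, `10¹²L³ε₀ ≤ 1`, `10¹⁰L⁶ε₀ ≤ 1`,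
`13·10¹⁴L³ε₀ ≤ 1`; `Lift`; the coupling `a > 0`, a coarse weight `c₁′ > 0`; (γ) `hco`; `hk_D` (E2E's text) at a rate `μ′ > r`; and the two NUMERIC conditions on `(r, ε)`:
`0 < Θ` (A4b's floor, `C_V := C_loc + C_P`, `θ_V` := px21's phase-class constant at `Ck := CkD`, `CQ := 6√(cB∕c₀)√ℓ⁻³`) and `(32√2ε₀e^{5r})(8e^{3r})·14 < 1`.  THEN
`∀ b Z bd, ‖toL2⁻¹(G₀(toL2 δ_bZ)) bd‖ ≤ √2·A₁·e^{−(min r (1∕4)∕2)·tdist(B b₋, B bd₋)}·‖Z‖` — ✓`kernelRow_GT_DeltaEtaSlot_rate` with `hVlow` := §1, `hVconj` := px21 ✓`hVconj_phaseClass_of_letters`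
(`hQ` := px17 ✓`norm_Qk_le_of_regPr`), `hkQ` := px21 ✓`hkQ_of_regPr` (`CkQ = 2a·5²(cB∕c₀)ℓ⁻⁶e^{μ′}`), `PosOnto` := (γ) + ✓`surjective_Qk_of_regPr`.  Default heartbeats (fits 100k).  CONDITIONAL on (γ), `hk_D`, `Lift`, the numeric conditions.
[cite: Balaban1985BackgroundPropagators, Thm 3.1 (3.42) p.397, (3.21)–(3.27) pp.394–395, (3.46) p.398, (3.49) p.399, Thm 3.11 p.416, Thm 3.12 p.422] -/
theorem kernelRow_GT_DeltaEtaSlot_of_lift (hnK : n < K) {ε₀ : ℝ} (hε₀ : 0 < ε₀) (hWε : 10 ^ 12 * (F.L : ℝ) ^ 3 * ε₀ ≤ 1)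
    (hε10 : 10 ^ 10 * (F.L : ℝ) ^ 6 * ε₀ ≤ 1) (hwin : 13 * 10 ^ 14 * (F.L : ℝ) ^ 3 * ε₀ ≤ 1)
    (U₀ : GaugeField (F.P K) 0 (Matrix.specialUnitaryGroup (Fin 2) ℂ)) (hreg : RegPr F n K ε₀ U₀)
    (hlift : ∀ cf : Site (F.P K) (K - n) → Matrix (Fin 2) (Fin 2) ℂ,
        (∀ e : PBond (F.P K) (K - n), cf e.src = ((emlIterU (K - n) (bgUnits F K U₀) e : (Matrix (Fin 2) (Fin 2) ℂ)ˣ) : Matrix (Fin 2) (Fin 2) ℂ) * cf e.tgt *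
          (((emlIterU (K - n) (bgUnits F K U₀) e)⁻¹ : (Matrix (Fin 2) (Fin 2) ℂ)ˣ) : Matrix (Fin 2) (Fin 2) ℂ)) →
        ∃ l₀ : Site (F.P K) 0 → Matrix (Fin 2) (Fin 2) ℂ,
          (∀ b : PBond (F.P K) 0, l₀ b.src = ((bgUnits F K U₀ b : (Matrix (Fin 2) (Fin 2) ℂ)ˣ) : Matrix (Fin 2) (Fin 2) ℂ) * l₀ b.tgt * (((bgUnits F K U₀ b)⁻¹ : (Matrix (Fin 2) (Fin 2) ℂ)ˣ) : Matrix (Fin 2) (Fin 2) ℂ)) ∧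
          ∀ y : Site (F.P K) (K - n), l₀ (embIter (K - n) y) = cf y)
    {a : ℝ} (ha : 0 < a) (c₁' : ℝ) (hc₁' : 0 < c₁')
    {γ : ℝ} (hγ : 0 < γ) (hco : ∀ v : BondL2K ℂ 3 (periodsT3 F K) c₀ W₂, γ * ‖v‖ ^ 2 ≤ RCLike.re ⟪v, laplaceA F n K h c₀ cB a (DeltaEtaSlot F n K c₀) U₀ v⟫_ℂ)
    {r μ' CkD : ℝ} (hr : 0 < r) (hrμ : r < μ') (hCkD : 0 ≤ CkD)
    (hkD : ∀ (b : PBond (F.P K) 0) (Z : Matrix (Fin 2) (Fin 2) ℂ) (bd : PBond (F.P K) 0),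
      ‖(toL2 F K c₀).symm (DL2 F n K c₀ U₀ (DstarL2 F n K c₀ U₀ (toL2 F K c₀ (Pi.single b Z))
          - RS F n K h c₀ cB U₀ (DstarL2 F n K c₀ U₀ (toL2 F K c₀ (Pi.single b Z))))) bd‖
        ≤ CkD * Real.exp (-(μ' * (Site.tdist (P := F.P K) (iterBlockOf (K - n) b.src) (iterBlockOf (K - n) bd.src) : ℝ))) * ‖Z‖)
    {ε : ℝ} (hε : 0 < ε) (hε1 : ε ≤ 1)
    (hΘ : 0 < ((1 - ε) * γ - ε * ((32 * Real.sqrt 2 * ε₀ * (((F.P K).d : ℝ) * (2 * 3) ^ (F.P K).d)) + (((2 / ((1 + (25 / 8) * (c₁' * ((((F.P K).L : ℝ) ^ (F.P K).d) ^ (K - n))⁻¹ / c₀)) * (600 * (27 / 4 : ℝ) ^ 6 * (c₀ * ((F.L : ℝ) ^ 3) ^ (K - n) / c₁') + a))) ^ 2 * a)⁻¹)) - 3 * (r ^ 2 * Real.exp (2 * r)) * (1 + 1 / ε)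
            - (a * (2 * Real.sqrt (216 * (Real.exp (r * (((F.P K).d : ℝ) + 1)) - 1) ^ 2 * (cB / (c₀ * ((F.L : ℝ) ^ (K - n)) ^ 3))) * (6 * Real.sqrt (cB / c₀) * Real.sqrt (((F.L : ℝ) ^ (K - n))⁻¹ ^ 3))
                  + 216 * (Real.exp (r * (((F.P K).d : ℝ) + 1)) - 1) ^ 2 * (cB / (c₀ * ((F.L : ℝ) ^ (K - n)) ^ 3)))
              + Real.sqrt 2 * CkD * (r * (F.P K).d * Real.exp (r * (F.P K).d) / min 1 ((μ' - r) / 2))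
                  * (((F.P K).d : ℝ) * ((((F.P K).L : ℝ) ^ (F.P K).d) ^ (K - n)) * (2 * (1 + 1 / (μ' - (r + min 1 ((μ' - r) / 2))))) ^ 3)
              + 32 * Real.sqrt 2 * ε₀ * (((F.P K).d : ℝ) * (2 * 3) ^ (F.P K).d) * (1 + Real.exp (2 * r)))))
    (hsmall : (32 * Real.sqrt 2 * ε₀ * Real.exp (5 * r)) * (8 * Real.exp (3 * r)) * 14 < 1)
    (b : PBond (F.P K) 0) (Z : Matrix (Fin 2) (Fin 2) ℂ) (bd : PBond (F.P K) 0) :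
    ‖(toL2 F K c₀).symm (GT F n K h c₀ cB a (DeltaEtaSlot F n K c₀) U₀ (toL2 F K c₀ (Pi.single b Z))) bd‖
      ≤ Real.sqrt 2 *
          (((1 + Real.sqrt 2 * (((2 * a * 5 ^ 2 * (cB / c₀) * ((F.L : ℝ) ^ (K - n))⁻¹ ^ 6 * Real.exp μ') + CkD) * Real.sqrt (((F.P K).d : ℝ) * ((((F.P K).L : ℝ) ^ (F.P K).d) ^ (K - n)) / c₀) * (Real.exp (6 * r) * Real.sqrt c₀ / ((1 - ε) * γ - ε * ((32 * Real.sqrt 2 * ε₀ * (((F.P K).d : ℝ) * (2 * 3) ^ (F.P K).d)) + (((2 / ((1 + (25 / 8) * (c₁' * ((((F.P K).L : ℝ) ^ (F.P K).d) ^ (K - n))⁻¹ / c₀)) * (600 * (27 / 4 : ℝ) ^ 6 * (c₀ * ((F.L : ℝ) ^ 3) ^ (K - n) / c₁') + a))) ^ 2 * a)⁻¹)) - 3 * (r ^ 2 * Real.exp (2 * r)) * (1 + 1 / ε)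
            - (a * (2 * Real.sqrt (216 * (Real.exp (r * (((F.P K).d : ℝ) + 1)) - 1) ^ 2 * (cB / (c₀ * ((F.L : ℝ) ^ (K - n)) ^ 3))) * (6 * Real.sqrt (cB / c₀) * Real.sqrt (((F.L : ℝ) ^ (K - n))⁻¹ ^ 3))
                  + 216 * (Real.exp (r * (((F.P K).d : ℝ) + 1)) - 1) ^ 2 * (cB / (c₀ * ((F.L : ℝ) ^ (K - n)) ^ 3)))
              + Real.sqrt 2 * CkD * (r * (F.P K).d * Real.exp (r * (F.P K).d) / min 1 ((μ' - r) / 2))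
                  * (((F.P K).d : ℝ) * ((((F.P K).L : ℝ) ^ (F.P K).d) ^ (K - n)) * (2 * (1 + 1 / (μ' - (r + min 1 ((μ' - r) / 2))))) ^ 3)
              + 32 * Real.sqrt 2 * ε₀ * (((F.P K).d : ℝ) * (2 * 3) ^ (F.P K).d) * (1 + Real.exp (2 * r))))) * (2 * (1 + 1 / (μ' - r))) ^ 3)) * (8 * Real.exp (3 * r)) * 14
              + Real.sqrt (3 ^ 3 * 8 / (c₀ * ((F.L : ℝ) ^ (K - n)) ^ 3)) * (Real.sqrt (8 * Real.exp (3 * r) * (2 * (1 + 1 / r)) ^ 3) * (Real.exp (6 * r) * Real.sqrt c₀ / ((1 - ε) * γ - ε * ((32 * Real.sqrt 2 * ε₀ * (((F.P K).d : ℝ) * (2 * 3) ^ (F.P K).d)) + (((2 / ((1 + (25 / 8) * (c₁' * ((((F.P K).L : ℝ) ^ (F.P K).d) ^ (K - n))⁻¹ / c₀)) * (600 * (27 / 4 : ℝ) ^ 6 * (c₀ * ((F.L : ℝ) ^ 3) ^ (K - n) / c₁') + a))) ^ 2 * a)⁻¹)) - 3 * (r ^ 2 * Real.exp (2 * r)) *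 (1 + 1 / ε)
            - (a * (2 * Real.sqrt (216 * (Real.exp (r * (((F.P K).d : ℝ) + 1)) - 1) ^ 2 * (cB / (c₀ * ((F.L : ℝ) ^ (K - n)) ^ 3))) * (6 * Real.sqrt (cB / c₀) * Real.sqrt (((F.L : ℝ) ^ (K - n))⁻¹ ^ 3))
                  + 216 * (Real.exp (r * (((F.P K).d : ℝ) + 1)) - 1) ^ 2 * (cB / (c₀ * ((F.L : ℝ) ^ (K - n)) ^ 3)))
              + Real.sqrt 2 * CkD * (r * (F.P K).d * Real.exp (r * (F.P K).d) / min 1 ((μ' - r) / 2))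
                  * (((F.P K).d : ℝ) * ((((F.P K).L : ℝ) ^ (F.P K).d) ^ (K - n)) * (2 * (1 + 1 / (μ' - (r + min 1 ((μ' - r) / 2))))) ^ 3)
              + 32 * Real.sqrt 2 * ε₀ * (((F.P K).d : ℝ) * (2 * 3) ^ (F.P K).d) * (1 + Real.exp (2 * r)))))))
            / (1 - (32 * Real.sqrt 2 * ε₀ * Real.exp (5 * r)) * (8 * Real.exp (3 * r)) * 14))
        * Real.exp (-((min r (1 / 4) / 2) * (Site.tdist (P := F.P K) (iterBlockOf (K - n) b.src) (iterBlockOf (K - n) bd.src) : ℝ))) * ‖Z‖ := by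
  have hc₀ : 0 < c₀ := Fact.out
  have hcB : 0 < cB := Fact.out
  -- `PosOnto` from (γ) and «Q onto»
  have hp : PosOnto F n K h c₀ cB a (DeltaEtaSlot F n K c₀) U₀ :=
    ⟨fun x hx => lt_of_lt_of_le (mul_pos hγ (pow_pos (norm_pos_iff.mpr hx) 2)) (hco x), surjective_Qk_of_regPr F h hnK c₀ cB hreg hwin⟩
  -- the letters fed by name
  have hQ : ∀ v : BondL2K ℂ 3 (periodsT3 F K) c₀ W₂, ‖Qk F n K h c₀ cB U₀ v‖ ≤ (6 * Real.sqrt (cB / c₀) * Real.sqrt (((F.L : ℝ) ^ (K - n))⁻¹ ^ 3)) * ‖v‖ :=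
    fun v => norm_Qk_le_of_regPr F h c₀ cB hε₀ hε10 hWε U₀ hreg v
  have hVconj := hVconj_phaseClass_of_letters F h c₀ cB (a := a) hε₀ hε10 hWε U₀ hreg ha.le hr.le hrμ hCkD hkD hQ
  have hVlow := hVlow_of_lift F h c₀ cB hnK hε₀ hWε U₀ hreg hlift ha c₁' hc₁'
  have hkQ := hkQ_of_regPr F h c₀ cB hε₀ hε10 hWε U₀ hreg ha.le (le_of_lt (hr.trans hrμ))
  exact kernelRow_GT_DeltaEtaSlot_rate (h := h) (cB := cB) (a := a) hnK.le hε₀.le U₀ hreg hp hr hε hε1 hco hVlow hVconj hΘ hCkD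
    (by positivity) hrμ hkD hkQ hsmall b Z bd

end Summit.QuantumFields.YangMills.Theorems.Prop7OneFormGreenKernelRowOfLift

end
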